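import Mathlib
import Summits.AtomisticToContinuum.HydrodynamicLimit.Theorems.ImplosionDichotomyDenseExcursionPackingAnalyticSonicTriangle

/-!
# Uniqueness of the holomorphic extension to the sonic triangle (identity theorem glue)
# (crux `DenseExcursion`, stmt-AtomisticToContinuum-12586, line `sonic-cavity-renewal` v9, stub `stub_analyticPackingImplosion`)

Helper file (`--supports stmt-AtomisticToContinuum-12586`, line lead a2, wave-5 worker D2, glue for the nested-triangle
(Cauchy–Kovalevskaya) induction of task (3), worker report `work/stubs/D2_triangle.REPORT.md` §3/§4 (R3)).
`sonicWindow_analytic_bound` produces, for EACH radius `ρ`, some holomorphic extension of the real order-`k` coefficient to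
`𝒟_ρ`; the induction needs ONE function on all the nested triangles. Kernel-checked here:

* `sonicTriangle_extension_unique` (REGISTERED helper): two functions holomorphic on `𝒟_ρ` that agree on the real window
  `(−3ρ, ρ)` agree on `𝒟_ρ` (identity theorem `AnalyticOnNhd.eqOn_of_preconnected_of_frequently_eq`: the triangle is convex
  hence preconnected, and the real points `ρ/(n+2) → 0` accumulate at the sonic point).

Sources: standard. NOT here: anything quantitative.
-/

noncomputable section

open Set Metric Filter Topology

namespace Summit.AtomisticToContinuum.HydrodynamicLimit.Theorems.PackingAnalyticImplosion

/-- **UNIQUENESS OF THE HOLOMORPHIC EXTENSION TO THE SONIC TRIANGLE** (registered helper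
`sonicTriangle_extension_unique` of `stub_analyticPackingImplosion`). [folklore] -/
theorem sonicTriangle_extension_unique : ∀ (ρ : ℝ) (U V : ℂ → ℂ), 0 < ρ → DifferentiableOn ℂ U {z : ℂ | -(3 * ρ) < z.re ∧ z.re < ρ ∧ |z.im| < (z.re + 3 * ρ) / 2} → DifferentiableOn ℂ V {z : ℂ | -(3 * ρ) < z.re ∧ z.re < ρ ∧ |z.im| < (z.re + 3 * ρ) / 2} → (∀ x ∈ Set.Ioo (-(3 * ρ)) ρ, U (x : ℂ) = V (x : ℂ)) → Set.EqOn U V {z : ℂ | -(3 * ρ) < z.re ∧ z.re < ρ ∧ |z.im| < (z.re + 3 * ρ) / 2} := by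
  intro ρ U V hρ hU hV hUV
  set D : Set ℂ := {z : ℂ | -(3 * ρ) < z.re ∧ z.re < ρ ∧ |z.im| < (z.re + 3 * ρ) / 2} with hD
  have hDo : IsOpen D := isOpen_sonicTriangle ρ
  have hUa : AnalyticOnNhd ℂ U D := hU.analyticOnNhd hDo
  have hVa : AnalyticOnNhd ℂ V D := hV.analyticOnNhd hDo
  have hpre : IsPreconnected D := (convex_sonicTriangle ρ).isPreconnected
  have h0 : (0 : ℂ) ∈ D := zero_mem_sonicTriangle hρ
  -- the real sequence `ρ/(n+2)` tends to `0` within `{0}ᶜ` and carries `U = V`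
  set a : ℕ → ℂ := fun n => ((ρ / ((n : ℝ) + 2) : ℝ) : ℂ) with ha
  have hapos : ∀ n : ℕ, 0 < ρ / ((n : ℝ) + 2) := fun n => div_pos hρ (by positivity)
  have hawin : ∀ n : ℕ, ρ / ((n : ℝ) + 2) ∈ Ioo (-(3 * ρ)) ρ := fun n => by
    refine ⟨by linarith [hapos n], ?_⟩
    rw [div_lt_iff₀ (by positivity)]; nlinarith
  have hlim : Tendsto a atTop (𝓝[≠] (0 : ℂ)) := by
    refine tendsto_nhdsWithin_iff.2 ⟨?_, Eventually.of_forall fun n => ?_⟩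
    · have h1 : Tendsto (fun n : ℕ => ρ / ((n : ℝ) + 2)) atTop (𝓝 0) := by
        have h2 : Tendsto (fun n : ℕ => (n : ℝ) + 2) atTop atTop :=
          tendsto_atTop_add_const_right _ _ tendsto_natCast_atTop_atTop
        exact h2.const_div_atTop ρ
      have h3 := (Complex.continuous_ofReal.tendsto 0).comp h1
      rw [Complex.ofReal_zero] at h3
      exact h3
    · simp only [ha, mem_compl_iff, mem_singleton_iff, Complex.ofReal_eq_zero]
      exact (hapos n).ne'
  have hfreq : ∃ᶠ z in 𝓝[≠] (0 : ℂ), U z = V z :=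
    hlim.frequently (Eventually.of_forall fun n => hUV _ (hawin n)).frequently
  exact hUa.eqOn_of_preconnected_of_frequently_eq hVa hpre h0 hfreq

end Summit.AtomisticToContinuum.HydrodynamicLimit.Theorems.PackingAnalyticImplosion

end
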